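import Summits.BirchSwinnertonDyer.Rank1Residual.Additive.RamifiedSevenGenusPartnerFP1Exact
import Summits.BirchSwinnertonDyer.Rank1Residual.Additive.RamifiedSevenGenusKatoExpUnitLawsOfFP1
import Summits.BirchSwinnertonDyer.Rank1Residual.Additive.RamifiedSevenGenusHeckeTwistDictionary
import Summits.BirchSwinnertonDyer.Rank1Residual.Additive.RamifiedSevenGenusLayerCharacters
import Summits.BirchSwinnertonDyer.Rank1Residual.Additive.RamifiedSevenGenusCharacterAveraging
import Summits.BirchSwinnertonDyer.Rank1Residual.Additive.RamifiedSevenPadicNormKernels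
import HarnessLib

set_option autoImplicit false

/-!
# `𝒞₇` genus road (crux `EllipticUnitValueSevenOfGZK` = stmt-BirchSwinnertonDyer-19945, K7r): (T-R) SOLUTION RIGIDITY of the ★-value law
# — `GenusSeven.unitLaw_position_rigid`, the letter of the zp v23 kernel stub `stub_unitLawPositionRigidSeven` VERBATIM

Cell bsd-cm, seat bsd-cm-k-ty1 g36 (literature-prover; OWNER of (T-R) per director-bsd (896) / pen bsd-cm-plan g40 D1182 (D)); letter = pen
sketch `bsd-cm-plan/g39/skel/TR.sketch.lean` 714888b02f72f96c with `(hRo) (hHecke) (hnf)` prepended and `(hC)` after the `W` instance binders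
= `bsd-cm-plan/g40/skel/TR.stub.txt`; route = pen brief `bsd-cm-plan/g40/TR-BRIEF.md` with step 3 replaced by Ramanujan averaging
(`Additive/RamifiedSevenGenusCharacterAveraging.lean`, p830657).  PURE KERNEL (theorems only): no named fact, no `sorry`, no `instance`, no notation.

THE STATEMENT.  At ONE pinned genus frame `Φ`, one reading `ι₇`, the class `x := I.resOver Φ.IK hγ Φ.isTopGenerator_γK Φ.zOne`, two solution tuples
`(uStar, e₁, α₀, α₁, n₀)`, `(uStar′, e₁′, α₀′, α₁′, n₀′)` of the ★-value law
`7^{e}·valOf ι₇ χ (uStar⁻¹ • x) = (ι₇α₀ + ι₇α₁·ιC(√−7))·Ω⁻¹·Lf 1` (all primitive layer characters `χ` of level `7^{n+1}`, `n ≥ n₀`, all depleted `Lf`)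
satisfy `v₇(α₀′² + 7α₁′²) + 2e₁ = v₇(α₀² + 7α₁²) + 2e₁′`.

THE PROOF (TR-BRIEF steps; every named input is a displayed hypothesis or a tree theorem).
1. GOOD CHARACTERS.  `hnf` gives the newform `f` of `W` (level `N_W`, `conductorNorm_pos_holds`); `Φ.r5'_of_facts hRo hC hf` a threshold `n₁` beyond
   which every primitive layer character `χ` has `Lf 1 ≠ 0` for every depleted `Lf`; `Φ.hL_of_inputs hHecke χ` an `Lf`; `Φ.Ω_ne_zero`;
   `A := ι₇α₀ + ι₇α₁·μ ≠ 0`, `A′ ≠ 0` (`padicReading_ne_zero`, `μ := Φ.ιC(√−7)`, `μ² = −7` = `Φ.ιC_sqrtNegSeven_sq`).  With `ρ_χ := evalHom ι₇ (χ(γK)⁻¹)`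
   (`valOf_units_inv_smul`) the two laws at a good `χ` give (★χ) `7^{e₁′}·A·ρ_χ(uStar) = 7^{e₁}·A′·ρ_χ(uStar′)`, i.e. `ρ_χ(w)·D = E` for
   `w := uStar′·uStar⁻¹`, `D := 7^{e₁}A′`, `E := 7^{e₁′}A`.
2. ONE FULL LEVEL.  `Φ.exists_character_isPrimitiveRoot N` (`N := max (max n₀ n₀′) n₁`) gives `χ₁` with `ζ₁ := χ₁(γK)` primitive of order `7^{N+1}`;
   the powers `χ₁^s`, `7 ∤ s`, are layer-trivial with `χ₁^s(γK) = ζ₁^s` primitive (`IsPrimitiveRoot.pow_of_coprime`), and `ρ_{χ₁^s} = evalHom ι₇ (ζ^s)`,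
   `ζ := ζ₁⁻¹`.
3. AVERAGING (p830657 `exists_padicInt_sum_units_evalHom_eq`): `∑_{s<7^{N+1}, 7∤s} ρ_{ζ^s}(w) = ι₇(c)`, `c ∈ ℤ₇`; summing (★) over the `k` unit
   residues: (AVG) `k·E = ι₇(c)·D`.
4. `w` IS CONSTANT.  `M := C(k)·w − C(c) ∈ Λ` has `ρ_χ(M)·D = k·E − ι₇(c)·D = 0` at EVERY good `χ` of EVERY level `≥ N`; if `M ≠ 0`, (M-CANCEL)
   `Φ.exists_level_forall_charEval_ne_zero` + `exists_character_isPrimitiveRoot` + `charEval_eq_evalHom` produce a good `χ` with `ρ_χ(M) ≠ 0` —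
   contradiction; so `C(k)·w = C(c)`, and on constant coefficients `k·w₀ = c` with `w₀ ∈ ℤ₇ˣ` (`PowerSeries.isUnit_constantCoeff`), hence
   `v₇(c) = v₇(k)` (`GenusSeven.valuation_units_eq_zero`).
5. ANISOTROPY.  (AVG) reads `ι₇(k·7^{e₁′}α₀ − c·7^{e₁}α₀′) + ι₇(k·7^{e₁′}α₁ − c·7^{e₁}α₁′)·μ = 0`, so both coordinates vanish
   (`CharacterEvaluation.eq_zero_of_add_mul_eq_zero_of_sq_eq_neg_seven`: `−7` is not a square in `ℚ₇`): `β·α = β′·α′` with `β := k·7^{e₁′}`,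
   `β′ := c·7^{e₁}` in `ℤ₇`.
6. VALUATIONS.  `β²(α₀² + 7α₁²) = β′²(α₀′² + 7α₁′²)`, both norm forms non-zero (`sq_add_seven_mul_sq_ne_zero`: `v(x²)` even, `v(7y²)` odd), and
   `v(β) = v(k) + e₁′`, `v(β′) = v(c) + e₁ = v(k) + e₁` (step 4) ⇒ the identity (`PadicInt.valuation_mul/_pow`, `valuation_p`, `omega`).

HONEST LABEL: a kernel lemma CONDITIONAL on the displayed named facts `hRo` (Rohrlich), `hHecke` (Hecke 1920), `hnf` (modularity), `h155u`; it closes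
NO stub by itself (the pen's touch (12b) keys `stub_unitLawPositionRigidSeven` to it); (S-P) = LEMMA P, PR^×, hR3c remain; stmt-BirchSwinnertonDyer-19945
stays OPEN; `X12.CMRamifiedSeven` is NOT proved; no summit statement is proved by this seat; BSD is claimed for no curve.

## References
* D. Rohrlich, *On L-functions of elliptic curves and cyclotomic towers*, Invent. Math. 75 (1984), Theorem (p. 409). [RohrlichInventiones1984]
* K. Kato, Astérisque 295 (2004), Thm. 12.5 (1)–(2) (p. 221), 13.5 (2) (p. 227), §13.9 and Lemma 13.10 (1) (p. 230). [Kato2004Asterisque]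
* L. Washington, *Introduction to Cyclotomic Fields* (1997), Thm. 7.3, §7.1–7.2, §13.1. [Washington1997]
* J.-P. Serre, *Local Fields* (1979), II §1–§2. [SerreLocalFields1979]
* Tree: `Additive/RamifiedSevenGenusIwasawaCharacterEvaluation.lean` (p823136), `…GenusHeckeTwistDictionary.lean` (`r5'_of_facts`),
  `…GenusHeckeTwists.lean` (`hL_of_inputs`), `…GenusLayerCharacters.lean` (`exists_character_isPrimitiveRoot`), `…PadicNormKernels.lean`
  (`padicReading_ne_zero`), `…GenusCharacterAveraging.lean` (p830657), `…GenusPartnerFP1Exact.lean` §0 (p830037); pen `g40/TR-BRIEF.md`, `g40/skel/TR.stub.txt`.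
-/

noncomputable section

open scoped NumberField TensorProduct
open WeierstrassCurve Field NumberField IsDedekindDomain Finset
open Literature.NumberTheory.IwasawaTheory
open Literature.NumberTheory.GaloisRepresentations Literature.NumberTheory.GaloisRepresentations.LocalWeilDatum
open Literature.NumberTheory.EllipticCurves
open Literature.NumberTheory.EllipticCurves.Rank1Residual
open Literature.NumberTheory.EllipticCurves.IwasawaAlgebra
open Literature.NumberTheory.EllipticCurves.Kato2004
open Literature.NumberTheory.EllipticCurves.ModularForms
open Literature.NumberTheory.ComplexMultiplication.EllipticUnits
open Summit.BirchSwinnertonDyer.Rank1Residual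

namespace Summit.BirchSwinnertonDyer.Rank1Residual.Additive.GenusSeven

/-! ## §0 Two small lemmas -/

/-- **Anisotropy of `x² + 7y²` on `ℤ₇`**: the form vanishes only at `(0, 0)` (`v(x²)` is even, `v(7y²)` odd). [cite: SerreLocalFields1979, II §1–§2] -/
theorem sq_add_seven_mul_sq_ne_zero [Fact (Nat.Prime 7)] {x y : ℤ_[7]} (h : x ≠ 0 ∨ y ≠ 0) : x ^ 2 + 7 * y ^ 2 ≠ 0 := by
  intro h0
  have hv7 : (7 : ℤ_[7]).valuation = 1 := by
    have h7 := PadicInt.valuation_p (p := 7)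
    simpa using h7
  have hx2 : x ^ 2 = -(7 * y ^ 2) := eq_neg_of_add_eq_zero_left h0
  rcases eq_or_ne y 0 with rfl | hy
  · have hx : x ≠ 0 := h.resolve_right (fun h1 ↦ h1 rfl)
    rw [zero_pow two_ne_zero, mul_zero, neg_zero] at hx2
    exact hx (pow_eq_zero_iff two_ne_zero |>.mp hx2)
  rcases eq_or_ne x 0 with rfl | hx
  · rw [zero_pow two_ne_zero, zero_eq_neg, mul_eq_zero] at hx2
    rcases hx2 with h7 | hy2
    · exact absurd h7 (by norm_num)
    · exact hy (pow_eq_zero_iff two_ne_zero |>.mp hy2)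
  have hv := congrArg PadicInt.valuation hx2
  rw [valuation_neg_eq, PadicInt.valuation_pow, PadicInt.valuation_mul (by norm_num) (pow_ne_zero _ hy),
    PadicInt.valuation_pow, hv7] at hv
  omega

/-- `evalHom` depends only on the evaluation point (its level witness is a proof). [cite: Washington1997, Prop. 7.2] -/
theorem CharacterEvaluation.evalHom_congr_point (ι₇ : ℚ_[7] →+* ℂ) {z₁ z₂ : ℂ} (h₁ : ∃ m : ℕ, z₁ ^ 7 ^ m = 1)
    (h₂ : ∃ m : ℕ, z₂ ^ 7 ^ m = 1) (h : z₁ = z₂) :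
    CharacterEvaluation.evalHom ι₇ z₁ h₁ = CharacterEvaluation.evalHom ι₇ z₂ h₂ := by
  subst h
  rfl

/-! ## §1 ★★★ (T-R) — solution rigidity of the ★-value law -/

set_option maxHeartbeats 4000000 in
open GenusSeven.ArithmeticInputs in
/-- ★★★ **(T-R) SOLUTION RIGIDITY** — the letter of zp v23's kernel stub `stub_unitLawPositionRigidSeven` VERBATIM (module docstring «THE
STATEMENT» / «THE PROOF»): two solutions of the ★-value law at one pinned genus frame have the same position integer
`v₇(α₀² + 7α₁²) − 2e`.  CONDITIONAL on the displayed named facts `hRo`, `hHecke`, `hnf`, `h155u`; closes no stub by itself.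
[cite: RohrlichInventiones1984, Theorem (p. 409)] [cite: Kato2004Asterisque, 13.5 (2) (p. 227), Thm. 12.5 (2) (p. 221), Lemma 13.10 (1) (p. 230)] [cite: Washington1997, Thm. 7.3, §13.1] -/
theorem unitLaw_position_rigid :
    ∀ (hRo : Rohrlich1988_nonvanishing_twists_anyLevel) (hHecke : Literature.NumberTheory.LFunctions.hecke1920_depletedHeckeL_entire)
      (hnf : ModularForms.exists_isNewformOf)
      (h155u : Kato2004.kato155_isUnit_of_two_le_primeDivisors)
      {W : WeierstrassCurve ℚ} [W.IsElliptic] [W.IsGloballyMinimal] [Fact (Nat.Prime 7)] (hC : X12.ClassCSeven W)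
      [ContinuousSMul ℤ_[7] (W.tateModule 7)] (K : ZpExtension ℚ 7) (hK : K.IsCyclotomic)
      {γ : Field.absoluteGaloisGroup ℚ} (hγ : K.IsTopGenerator γ) (I : IwasawaH1Data W 7 K γ)
      (F : GenusFrame)
      (Kcm : Type) [Field Kcm] [NumberField Kcm] (h2 : Module.finrank ℚ Kcm = 2) (s : 𝓞 Kcm) (hs : (s : Kcm) ^ 2 = -7)
      (ι₀ : Kcm →+* ℂ) (e : AlgebraicClosure Kcm →+* AlgebraicClosure ℚ)
      (𝔞 : Ideal (𝓞 Kcm)) (h𝔞 : IsTwist 7 (Ideal.span {s} * Ideal.span {((F.d : ℕ) : 𝓞 Kcm)}) 𝔞)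
      (hN𝔞 : Ideal.absNorm 𝔞 = F.normA) (z : ℕ → (AlgebraicClosure Kcm)ˣ)
      (hz : ∀ n : ℕ, IsKatoUnitRep 7 ι₀ (Ideal.span {s} * Ideal.span {((F.d : ℕ) : 𝓞 Kcm)}) (n + 1) 𝔞 (z n))
      (d : GenusDatum F (normedFamilyOf F Kcm h2 s hs ι₀ e 𝔞 h𝔞 hN𝔞 z hz h155u))
      (ι₇ : ℚ_[7] →+* ℂ) (Φ : PinnedKatoGenusFrame W K hK I d)
      (uStar : (IwasawaAlgebra 7)ˣ) (e₁ : ℕ) (α₀ α₁ : ℤ_[7]), (α₀ ≠ 0 ∨ α₁ ≠ 0) → ∀ (n₀ : ℕ),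
      (∀ (n : ℕ), n₀ ≤ n → ∀ (χ : absoluteGaloisGroup Φ.Kcm →ₜ* ℂˣ),
            (∀ σ ∈ Φ.towerK.layerSubgroup (n + 1), χ σ = 1) →
            IsPrimitiveRoot (((χ Φ.γK : ℂˣ)) : ℂ) (7 ^ (n + 1)) →
            ∀ Lf : ℂ → ℂ, CM.IsDepletedHeckeL Φ.ψ χ (7 * (7 * F.d)) Lf →
              (7 : ℂ) ^ e₁ * Φ.valOf ι₇ χ (uStar⁻¹ • I.resOver Φ.IK hγ Φ.isTopGenerator_γK Φ.zOne) =
                (ι₇ (α₀ : ℚ_[7]) + ι₇ (α₁ : ℚ_[7]) * Φ.ιC (algebraMap Φ.Kcm (AlgebraicClosure Φ.Kcm) Φ.sqrtNegSeven)) * Φ.Ω⁻¹ * Lf 1) →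
      ∀ (uStar' : (IwasawaAlgebra 7)ˣ) (e₁' : ℕ) (α₀' α₁' : ℤ_[7]), (α₀' ≠ 0 ∨ α₁' ≠ 0) → ∀ (n₀' : ℕ),
      (∀ (n : ℕ), n₀' ≤ n → ∀ (χ : absoluteGaloisGroup Φ.Kcm →ₜ* ℂˣ),
            (∀ σ ∈ Φ.towerK.layerSubgroup (n + 1), χ σ = 1) →
            IsPrimitiveRoot (((χ Φ.γK : ℂˣ)) : ℂ) (7 ^ (n + 1)) →
            ∀ Lf : ℂ → ℂ, CM.IsDepletedHeckeL Φ.ψ χ (7 * (7 * F.d)) Lf →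
              (7 : ℂ) ^ e₁' * Φ.valOf ι₇ χ (uStar'⁻¹ • I.resOver Φ.IK hγ Φ.isTopGenerator_γK Φ.zOne) =
                (ι₇ (α₀' : ℚ_[7]) + ι₇ (α₁' : ℚ_[7]) * Φ.ιC (algebraMap Φ.Kcm (AlgebraicClosure Φ.Kcm) Φ.sqrtNegSeven)) * Φ.Ω⁻¹ * Lf 1) →
      (α₀' ^ 2 + 7 * α₁' ^ 2).valuation + 2 * e₁ = (α₀ ^ 2 + 7 * α₁ ^ 2).valuation + 2 * e₁' := by
  intro hRo hHecke hnf h155u W _ _ _ hC _ K hK γ hγ I F Kcm _ _ h2 s hs ι₀ e 𝔞 h𝔞 hN𝔞 z hz d ι₇ Φ uStar e₁ α₀ α₁ hα n₀ hZ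
    uStar' e₁' α₀' α₁' hα' n₀' hZ'
  classical
  -- STEP 1: the good characters and the relation (★χ)
  have hμ2 : Φ.ιC (algebraMap Φ.Kcm (AlgebraicClosure Φ.Kcm) Φ.sqrtNegSeven) ^ 2 = -7 := Φ.ιC_sqrtNegSeven_sq
  have hA0 : ι₇ (α₀ : ℚ_[7]) + ι₇ (α₁ : ℚ_[7]) * Φ.ιC (algebraMap Φ.Kcm (AlgebraicClosure Φ.Kcm) Φ.sqrtNegSeven) ≠ 0 :=
    padicReading_ne_zero ι₇ _ hμ2 hα
  have hA0' : ι₇ (α₀' : ℚ_[7]) + ι₇ (α₁' : ℚ_[7]) * Φ.ιC (algebraMap Φ.Kcm (AlgebraicClosure Φ.Kcm) Φ.sqrtNegSeven) ≠ 0 :=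
    padicReading_ne_zero ι₇ _ hμ2 hα'
  set D : ℂ := (7 : ℂ) ^ e₁ * (ι₇ (α₀' : ℚ_[7]) + ι₇ (α₁' : ℚ_[7]) * Φ.ιC (algebraMap Φ.Kcm (AlgebraicClosure Φ.Kcm) Φ.sqrtNegSeven))
    with hDdef
  set E : ℂ := (7 : ℂ) ^ e₁' * (ι₇ (α₀ : ℚ_[7]) + ι₇ (α₁ : ℚ_[7]) * Φ.ιC (algebraMap Φ.Kcm (AlgebraicClosure Φ.Kcm) Φ.sqrtNegSeven))
    with hEdef
  have hD0 : D ≠ 0 := mul_ne_zero (pow_ne_zero _ (by norm_num)) hA0'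
  haveI : NeZero (W.conductorNorm ℤ) := ⟨(W.conductorNorm_pos_holds).ne'⟩
  obtain ⟨f, hf⟩ := hnf W
  obtain ⟨n₁, hn₁⟩ := Φ.r5'_of_facts hRo hC hf
  set N : ℕ := max (max n₀ n₀') n₁ with hNdef
  -- (★χ): at every primitive layer character of level `n + 1`, `n ≥ N`: `ρ_χ(w) · D = E`
  have key : ∀ n : ℕ, N ≤ n → ∀ (χ : absoluteGaloisGroup Φ.Kcm →ₜ* ℂˣ)
      (hχ : ∀ σ ∈ Φ.towerK.layerSubgroup (n + 1), χ σ = 1), IsPrimitiveRoot (((χ Φ.γK : ℂˣ)) : ℂ) (7 ^ (n + 1)) →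
      CharacterEvaluation.evalHom ι₇ ((((χ Φ.γK)⁻¹ : ℂˣ)) : ℂ) ⟨n + 1, Φ.inv_chi_γK_pow_eq_one χ hχ⟩
          ((uStar' * uStar⁻¹ : (IwasawaAlgebra 7)ˣ) : IwasawaAlgebra 7) * D = E := by
    intro n hn χ hχ hprim
    have hn0 : n₀ ≤ n := (le_max_left n₀ n₀').trans ((le_max_left _ n₁).trans hn)
    have hn0' : n₀' ≤ n := (le_max_right n₀ n₀').trans ((le_max_left _ n₁).trans hn)
    have hn1 : n₁ ≤ n := (le_max_right _ n₁).trans hn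
    obtain ⟨Lf, hLf⟩ := Φ.hL_of_inputs hHecke χ
    have hL0 : Lf 1 ≠ 0 := hn₁ n hn1 χ hχ hprim Lf hLf
    have h1 := hZ n hn0 χ hχ hprim Lf hLf
    have h2 := hZ' n hn0' χ hχ hprim Lf hLf
    rw [Φ.valOf_units_inv_smul ι₇ χ hχ] at h1 h2
    set ρ := CharacterEvaluation.evalHom ι₇ ((((χ Φ.γK)⁻¹ : ℂˣ)) : ℂ) ⟨n + 1, Φ.inv_chi_γK_pow_eq_one χ hχ⟩ with hρ
    set V : ℂ := Φ.valOf ι₇ χ (I.resOver Φ.IK hγ Φ.isTopGenerator_γK Φ.zOne) with hV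
    have hρu : ρ (uStar : IwasawaAlgebra 7) ≠ 0 := CharacterEvaluation.evalHom_units_ne_zero ι₇ _ _ uStar
    have hρu' : ρ (uStar' : IwasawaAlgebra 7) ≠ 0 := CharacterEvaluation.evalHom_units_ne_zero ι₇ _ _ uStar'
    -- `7^{e₁} V = A Ω⁻¹ L ρ(u)`, `7^{e₁'} V = A' Ω⁻¹ L ρ(u')`
    have e1 : (7 : ℂ) ^ e₁ * V = (ι₇ (α₀ : ℚ_[7]) + ι₇ (α₁ : ℚ_[7]) * Φ.ιC (algebraMap Φ.Kcm (AlgebraicClosure Φ.Kcm) Φ.sqrtNegSeven)) *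
        Φ.Ω⁻¹ * Lf 1 * ρ (uStar : IwasawaAlgebra 7) := by
      rw [← h1]
      field_simp
    have e2 : (7 : ℂ) ^ e₁' * V = (ι₇ (α₀' : ℚ_[7]) + ι₇ (α₁' : ℚ_[7]) * Φ.ιC (algebraMap Φ.Kcm (AlgebraicClosure Φ.Kcm) Φ.sqrtNegSeven)) *
        Φ.Ω⁻¹ * Lf 1 * ρ (uStar' : IwasawaAlgebra 7) := by
      rw [← h2]
      field_simp
    have h3 : (Φ.Ω⁻¹ * Lf 1) * (E * ρ (uStar : IwasawaAlgebra 7)) = (Φ.Ω⁻¹ * Lf 1) * (D * ρ (uStar' : IwasawaAlgebra 7)) := by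
      calc (Φ.Ω⁻¹ * Lf 1) * (E * ρ (uStar : IwasawaAlgebra 7)) = (7 : ℂ) ^ e₁' * ((7 : ℂ) ^ e₁ * V) := by rw [e1, hEdef]; ring
        _ = (7 : ℂ) ^ e₁ * ((7 : ℂ) ^ e₁' * V) := by ring
        _ = (Φ.Ω⁻¹ * Lf 1) * (D * ρ (uStar' : IwasawaAlgebra 7)) := by rw [e2, hDdef]; ring
    have hk : E * ρ (uStar : IwasawaAlgebra 7) = D * ρ (uStar' : IwasawaAlgebra 7) :=
      mul_left_cancel₀ (mul_ne_zero (inv_ne_zero Φ.Ω_ne_zero) hL0) h3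
    rw [Units.val_mul, map_mul, map_units_inv]
    calc ρ (uStar' : IwasawaAlgebra 7) * (ρ (uStar : IwasawaAlgebra 7))⁻¹ * D
        = (ρ (uStar : IwasawaAlgebra 7))⁻¹ * (D * ρ (uStar' : IwasawaAlgebra 7)) := by ring
      _ = (ρ (uStar : IwasawaAlgebra 7))⁻¹ * (E * ρ (uStar : IwasawaAlgebra 7)) := by rw [hk]
      _ = E := by rw [mul_comm E, ← mul_assoc, inv_mul_cancel₀ hρu, one_mul]
  -- STEP 2: one full level `N + 1`: the character `χ₁` and its prime-to-7 powers
  obtain ⟨χ₁, hχ₁, hprim₁⟩ := Φ.exists_character_isPrimitiveRoot N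
  set ζ : ℂ := ((((χ₁ Φ.γK)⁻¹ : ℂˣ)) : ℂ) with hζdef
  have hζ : ζ ^ 7 ^ (N + 1) = 1 := Φ.inv_chi_γK_pow_eq_one χ₁ hχ₁
  have hζs : ∀ s : ℕ, ∃ m : ℕ, (ζ ^ s) ^ 7 ^ m = 1 := fun s ↦ ⟨N + 1, by rw [← pow_mul, mul_comm, pow_mul, hζ, one_pow]⟩
  have hχs : ∀ s : ℕ, ∀ σ ∈ Φ.towerK.layerSubgroup (N + 1), (χ₁ ^ s) σ = 1 := fun s σ hσ ↦ by
    rw [ContinuousMonoidHom.pow_apply, hχ₁ σ hσ, one_pow]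
  have hprims : ∀ s : ℕ, ¬ 7 ∣ s → IsPrimitiveRoot ((((χ₁ ^ s) Φ.γK : ℂˣ)) : ℂ) (7 ^ (N + 1)) := fun s hs7 ↦ by
    rw [ContinuousMonoidHom.pow_apply, Units.val_pow_eq_pow_val]
    exact hprim₁.pow_of_coprime s (((Nat.Prime.coprime_iff_not_dvd (by norm_num)).mpr hs7).symm.pow_right (N + 1))
  have hpt : ∀ s : ℕ, (((((χ₁ ^ s) Φ.γK)⁻¹ : ℂˣ)) : ℂ) = ζ ^ s := fun s ↦ by
    rw [hζdef, ContinuousMonoidHom.pow_apply, ← inv_pow, Units.val_pow_eq_pow_val]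
  set U : Finset ℕ := (range (7 ^ (N + 1))).filter (fun s ↦ ¬ 7 ∣ s) with hUdef
  have hper : ∀ s ∈ U, CharacterEvaluation.evalHom ι₇ (ζ ^ s) (hζs s)
      ((uStar' * uStar⁻¹ : (IwasawaAlgebra 7)ˣ) : IwasawaAlgebra 7) * D = E := by
    intro s hsU
    have hs7 : ¬ 7 ∣ s := (mem_filter.mp hsU).2
    have hk := key N le_rfl (χ₁ ^ s) (hχs s) (hprims s hs7)
    rwa [CharacterEvaluation.evalHom_congr_point ι₇ _ (hζs s) (hpt s)] at hk
  -- STEP 3: Ramanujan averaging over the level: `k · E = ι₇(c) · D`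
  obtain ⟨c, hc⟩ := CharacterEvaluation.exists_padicInt_sum_units_evalHom_eq ι₇ hζ hζs
    ((uStar' * uStar⁻¹ : (IwasawaAlgebra 7)ˣ) : IwasawaAlgebra 7)
  have hAVG : (U.card : ℂ) * E = ι₇ (c : ℚ_[7]) * D := by
    have h1 : ∑ s ∈ U, CharacterEvaluation.evalHom ι₇ (ζ ^ s) (hζs s)
        ((uStar' * uStar⁻¹ : (IwasawaAlgebra 7)ˣ) : IwasawaAlgebra 7) * D = ∑ s ∈ U, E := Finset.sum_congr rfl hper
    rw [← Finset.sum_mul, hc, Finset.sum_const, nsmul_eq_mul] at h1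
    exact h1.symm
  -- STEP 4: `M := C(k)·w − C(c)` dies at every good character, hence `M = 0`
  set M : IwasawaAlgebra 7 := PowerSeries.C ((U.card : ℕ) : ℤ_[7]) * ((uStar' * uStar⁻¹ : (IwasawaAlgebra 7)ˣ) : IwasawaAlgebra 7) -
    PowerSeries.C c with hMdef
  have hMeval : ∀ n : ℕ, N ≤ n → ∀ (χ : absoluteGaloisGroup Φ.Kcm →ₜ* ℂˣ)
      (hχ : ∀ σ ∈ Φ.towerK.layerSubgroup (n + 1), χ σ = 1), IsPrimitiveRoot (((χ Φ.γK : ℂˣ)) : ℂ) (7 ^ (n + 1)) →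
      CharacterEvaluation.evalHom ι₇ ((((χ Φ.γK)⁻¹ : ℂˣ)) : ℂ) ⟨n + 1, Φ.inv_chi_γK_pow_eq_one χ hχ⟩ M = 0 := by
    intro n hn χ hχ hprim
    have hw := key n hn χ hχ hprim
    set ρ := CharacterEvaluation.evalHom ι₇ ((((χ Φ.γK)⁻¹ : ℂˣ)) : ℂ) ⟨n + 1, Φ.inv_chi_γK_pow_eq_one χ hχ⟩ with hρ
    have hρM : ρ M = (U.card : ℂ) * ρ ((uStar' * uStar⁻¹ : (IwasawaAlgebra 7)ˣ) : IwasawaAlgebra 7) - ι₇ (c : ℚ_[7]) := by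
      rw [hMdef, map_sub, map_mul, CharacterEvaluation.evalHom_C, CharacterEvaluation.evalHom_C, PadicInt.coe_natCast, map_natCast]
    have h0 : ρ M * D = 0 := by
      rw [hρM, sub_mul, mul_assoc, hw, hAVG]
      ring
    exact (mul_eq_zero.mp h0).resolve_right hD0
  have hM0 : M = 0 := by
    by_contra hM
    obtain ⟨n₂, hn₂⟩ := Φ.exists_level_forall_charEval_ne_zero ι₇ hM
    obtain ⟨χ, hχ, hprim⟩ := Φ.exists_character_isPrimitiveRoot (max N n₂)
    have h1 := hn₂ (max N n₂) (le_max_right _ _) χ hprim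
    rw [CharacterEvaluation.charEval_eq_evalHom ι₇ (Φ.inv_chi_γK_pow_eq_one χ hχ)] at h1
    exact h1 (hMeval (max N n₂) (le_max_left _ _) χ hχ hprim)
  -- constant coefficients: `k · w₀ = c`, `w₀` a unit, so `v₇(c) = v₇(k)`
  have hcoef : ((U.card : ℕ) : ℤ_[7]) * PowerSeries.constantCoeff ((uStar' * uStar⁻¹ : (IwasawaAlgebra 7)ˣ) : IwasawaAlgebra 7) = c := by
    have h1 := congrArg PowerSeries.constantCoeff (sub_eq_zero.mp hM0)
    rwa [map_mul, PowerSeries.constantCoeff_C, PowerSeries.constantCoeff_C] at h1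
  have hw0 : IsUnit (PowerSeries.constantCoeff ((uStar' * uStar⁻¹ : (IwasawaAlgebra 7)ˣ) : IwasawaAlgebra 7)) :=
    PowerSeries.isUnit_constantCoeff _ (Units.isUnit _)
  have hU1 : 1 ∈ U := by
    rw [hUdef, mem_filter, mem_range]
    exact ⟨Nat.one_lt_pow (Nat.succ_ne_zero N) (by norm_num), by norm_num⟩
  have hkpos : 0 < U.card := Finset.card_pos.mpr ⟨1, hU1⟩
  have hk0 : ((U.card : ℕ) : ℤ_[7]) ≠ 0 := by exact_mod_cast hkpos.ne'
  have hc0 : c ≠ 0 := by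
    rw [← hcoef]
    exact mul_ne_zero hk0 hw0.ne_zero
  have hvc : c.valuation = ((U.card : ℕ) : ℤ_[7]).valuation := by
    have hvw0 : (PowerSeries.constantCoeff ((uStar' * uStar⁻¹ : (IwasawaAlgebra 7)ˣ) : IwasawaAlgebra 7)).valuation = 0 := by
      rw [← hw0.unit_spec]
      exact valuation_units_eq_zero hw0.unit
    rw [← hcoef, PadicInt.valuation_mul hk0 hw0.ne_zero, hvw0, add_zero]
  -- STEP 5: anisotropy — the two coordinates of (AVG) vanish
  have hXY := CharacterEvaluation.eq_zero_of_add_mul_eq_zero_of_sq_eq_neg_seven ι₇ hμ2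
    (a := (U.card : ℚ_[7]) * (7 : ℚ_[7]) ^ e₁' * (α₀ : ℚ_[7]) - (c : ℚ_[7]) * (7 : ℚ_[7]) ^ e₁ * (α₀' : ℚ_[7]))
    (b := (U.card : ℚ_[7]) * (7 : ℚ_[7]) ^ e₁' * (α₁ : ℚ_[7]) - (c : ℚ_[7]) * (7 : ℚ_[7]) ^ e₁ * (α₁' : ℚ_[7])) (by
      simp only [map_sub, map_mul, map_pow, map_natCast, map_ofNat]
      rw [hEdef, hDdef] at hAVG
      linear_combination hAVG)
  obtain ⟨hX, hY⟩ := hXY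
  have hX' : ((U.card : ℕ) : ℤ_[7]) * (7 : ℤ_[7]) ^ e₁' * α₀ = c * (7 : ℤ_[7]) ^ e₁ * α₀' := by
    apply PadicInt.ext
    rw [PadicInt.coe_mul, PadicInt.coe_mul, PadicInt.coe_mul, PadicInt.coe_mul, PadicInt.coe_pow, PadicInt.coe_pow,
      PadicInt.coe_natCast, show ((7 : ℤ_[7]) : ℚ_[7]) = 7 from rfl]
    linear_combination hX
  have hY' : ((U.card : ℕ) : ℤ_[7]) * (7 : ℤ_[7]) ^ e₁' * α₁ = c * (7 : ℤ_[7]) ^ e₁ * α₁' := by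
    apply PadicInt.ext
    rw [PadicInt.coe_mul, PadicInt.coe_mul, PadicInt.coe_mul, PadicInt.coe_mul, PadicInt.coe_pow, PadicInt.coe_pow,
      PadicInt.coe_natCast, show ((7 : ℤ_[7]) : ℚ_[7]) = 7 from rfl]
    linear_combination hY
  -- STEP 6: valuations
  have hS : (((U.card : ℕ) : ℤ_[7]) * (7 : ℤ_[7]) ^ e₁') ^ 2 * (α₀ ^ 2 + 7 * α₁ ^ 2) =
      (c * (7 : ℤ_[7]) ^ e₁) ^ 2 * (α₀' ^ 2 + 7 * α₁' ^ 2) := by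
    have h0 : (((U.card : ℕ) : ℤ_[7]) * (7 : ℤ_[7]) ^ e₁' * α₀) ^ 2 = (c * (7 : ℤ_[7]) ^ e₁ * α₀') ^ 2 := by rw [hX']
    have h1 : (((U.card : ℕ) : ℤ_[7]) * (7 : ℤ_[7]) ^ e₁' * α₁) ^ 2 = (c * (7 : ℤ_[7]) ^ e₁ * α₁') ^ 2 := by rw [hY']
    linear_combination h0 + 7 * h1
  have hv7 : (7 : ℤ_[7]).valuation = 1 := by
    have h7 := PadicInt.valuation_p (p := 7)
    simpa using h7
  have h70 : (7 : ℤ_[7]) ≠ 0 := by norm_num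
  have hS0 : α₀ ^ 2 + 7 * α₁ ^ 2 ≠ 0 := sq_add_seven_mul_sq_ne_zero hα
  have hS0' : α₀' ^ 2 + 7 * α₁' ^ 2 ≠ 0 := sq_add_seven_mul_sq_ne_zero hα'
  have hβ : ((U.card : ℕ) : ℤ_[7]) * (7 : ℤ_[7]) ^ e₁' ≠ 0 := mul_ne_zero hk0 (pow_ne_zero _ h70)
  have hβ' : c * (7 : ℤ_[7]) ^ e₁ ≠ 0 := mul_ne_zero hc0 (pow_ne_zero _ h70)
  have hv := congrArg PadicInt.valuation hS
  rw [PadicInt.valuation_mul (pow_ne_zero _ hβ) hS0, PadicInt.valuation_mul (pow_ne_zero _ hβ') hS0',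
    PadicInt.valuation_pow, PadicInt.valuation_pow, PadicInt.valuation_mul hk0 (pow_ne_zero _ h70),
    PadicInt.valuation_mul hc0 (pow_ne_zero _ h70), PadicInt.valuation_pow, PadicInt.valuation_pow, hv7, hvc] at hv
  omega

end Summit.BirchSwinnertonDyer.Rank1Residual.Additive.GenusSeven

end
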